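import Literature.NumberTheory.EllipticCurves.Rank1Residual.CyclotomicWindingSpan
import Literature.NumberTheory.EllipticCurves.ModularSymbols
import HarnessLib

/-!
# Crux-triage seat 1 (GEN 4), card #8 `odd-point-shimura-descent-two`: the typed step S3
`EisensteinOfTwoFlatAtTwo` (SketchOddPointShimuraDescentTwo.lean:187–190) is FALSE AS TYPED —
it quantifies over ALL `f : CuspForm (Gamma0 N) 2`, and for `f = 0` the hypothesis
`IsIntegerFunctional f m` holds for EVERY `m : Γ₀(N) → ℤ` (both sides are `0`), so `m` is free;
a 2-flat `m` that is not a function of `d (mod N)` then violates the conclusion.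
Witness: `N = 3`, `f = 0`, `m γ = [dEntry γ = 19]`, `ε = 0`, `γ₁ = (1 6; 3 19)`, `u = 1`.
REPAIR (misstated, not substantive): state S3 for a HOMOMORPHISM `m` killing finite-order and
trace-±2 elements (all THEOREM B uses), or add `0 < plusPeriod f ∧ realPeriods f = zmultiples (plusPeriod f/2)`.
The defs below are copied VERBATIM from the sketch (crux-dir modules are not importable).
-/

noncomputable section

open scoped MatrixGroups ModularForm
open CongruenceSubgroup Literature.NumberTheory.EllipticCurves
  Literature.NumberTheory.EllipticCurves.ModularForms Literature.NumberTheory.EllipticCurves.Rank1Residual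

namespace TriageS3Hole

def IsIntegerFunctional {N : ℕ} (f : CuspForm (Gamma0 N) 2) (m : Gamma0 N → ℤ) : Prop :=
  ∀ γ : Gamma0 N, (cuspSymbol f γ).re = m γ * (plusPeriod f / 2)

def TwoFlatWith {N : ℕ} (m : Gamma0 N → ℤ) (ε : ZMod 2) : Prop :=
  ∀ (γ : Gamma0 N) (k : ℕ), (dEntry γ).natAbs = 2 ^ k → ((m γ : ℤ) : ZMod 2) = (k : ZMod 2) * ε

def IsEisensteinModTwo {N : ℕ} (m : Gamma0 N → ℤ) (ψ : (ZMod N)ˣ →* Multiplicative (ZMod 2)) : Prop :=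
  ∀ (γ : Gamma0 N) (u : (ZMod N)ˣ), (u : ZMod N) = ((dEntry γ : ℤ) : ZMod N) →
    ((m γ : ℤ) : ZMod 2) = Multiplicative.toAdd (ψ u)

def EisensteinOfTwoFlatAtTwo : Prop :=
  ∀ (N : ℕ) [NeZero N] (f : CuspForm (Gamma0 N) 2) (m : Gamma0 N → ℤ) (ε : ZMod 2), Odd N →
    IsIntegerFunctional f m → TwoFlatWith m ε →
    ∃ ψ : (ZMod N)ˣ →* Multiplicative (ZMod 2), IsEisensteinModTwo m ψ

/-- `γ₁ = (1 6; 3 19) ∈ SL(2,ℤ)`. -/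
def g₁ : SL(2, ℤ) := ⟨!![1, 6; 3, 19], by norm_num [Matrix.det_fin_two_of]⟩

/-- `γ₁ ∈ Γ₀(3)`. -/
def γ₁ : Gamma0 3 := ⟨g₁, by rw [Gamma0_mem]; simp [g₁]; decide⟩

theorem dEntry_γ₁ : dEntry γ₁ = 19 := by
  simp [dEntry, γ₁, g₁]

theorem cuspSymbol_zero {N : ℕ} (γ : Gamma0 N) : cuspSymbol (0 : CuspForm (Gamma0 N) 2) γ = 0 := by
  unfold cuspSymbol modularSymbol
  simp

theorem periodLattice_zero {N : ℕ} : periodLattice (0 : CuspForm (Gamma0 N) 2) = ⊥ := by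
  unfold periodLattice
  rw [AddSubgroup.closure_eq_bot_iff]
  rintro _ ⟨γ, rfl⟩
  exact cuspSymbol_zero γ

theorem plusPeriod_zero {N : ℕ} : plusPeriod (0 : CuspForm (Gamma0 N) 2) = 0 := by
  unfold plusPeriod
  rw [dif_neg]
  rintro ⟨Ω, hΩ, h⟩
  have hre : realPeriods (0 : CuspForm (Gamma0 N) 2) = ⊥ := by
    unfold realPeriods; rw [periodLattice_zero]; simp
  rw [hre] at h
  have hmem : Ω / 2 ∈ AddSubgroup.zmultiples (Ω / 2) := AddSubgroup.mem_zmultiples _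
  rw [← h] at hmem
  have : Ω / 2 = 0 := hmem
  linarith

/-- **S3 as typed is false.** -/
theorem not_eisensteinOfTwoFlatAtTwo : ¬ EisensteinOfTwoFlatAtTwo := by
  intro h
  let m : Gamma0 3 → ℤ := fun γ => if dEntry γ = 19 then 1 else 0
  have hint : IsIntegerFunctional (0 : CuspForm (Gamma0 3) 2) m := by
    intro γ
    simp [cuspSymbol_zero, plusPeriod_zero]
  have hflat : TwoFlatWith m 0 := by
    intro γ k hk
    simp only [mul_zero]
    by_cases hd : dEntry γ = 19
    · exfalso
      rw [hd] at hk
      obtain _ | k := k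
      · simp at hk
      · rw [pow_succ] at hk; omega
    · simp [m, hd]
  obtain ⟨ψ, hψ⟩ := h 3 0 m 0 (by decide) hint hflat
  have h19 : ((1 : (ZMod 3)ˣ) : ZMod 3) = ((dEntry γ₁ : ℤ) : ZMod 3) := by
    rw [dEntry_γ₁]; decide
  have := hψ γ₁ 1 h19
  simp [m, dEntry_γ₁] at this

end TriageS3Hole

end

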